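import Mathlib
import Literature.NumberTheory.ComplexMultiplication.ReflexType
import HarnessLib

/-!
# The Galois group acting on the embeddings of a subextension

The concrete action behind `Literature.NumberTheory.ComplexMultiplication.ReflexType`: for fields `F ⊆ Ω` and an
`F`-algebra `K`, the group `Ω ≃ₐ[F] Ω` acts on the embeddings `K →ₐ[F] Ω` by composition, `σ • φ = σ ∘ φ`
(scoped instance `algEquivCompAction`), and when `Ω/F` is normal the action is TRANSITIVE
(`exists_algEquiv_smul_eq`, scoped instance `isPretransitive_algEquiv_algHom`): any two `F`-embeddings of `K`
into `Ω` differ by an automorphism of `Ω` (extension of embeddings to the normal extension, Mathlib's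
`AlgHom.liftNormal`).  This is the standing setting of Shimura, *Abelian Varieties with Complex Multiplication
and Modular Functions* (1998) §8.1, Prop. 25 [Shimura1998] ("Let `L` be a Galois extension of `ℚ` containing
`F`, and `G` the Galois group of `L` over `ℚ` … `S` the set of all the elements of `G` inducing some `φᵢ` on
`F`"), where every embedding of `F` is induced by elements of `G`.  The stabiliser of an embedding `φ` is
`Gal(Ω/φ(K))` (`stabilizer_algHom_eq_fixingSubgroup`), so that in the Galois case the abstract statements of
`ReflexType` read on fields: the reflex field of the reflex type lies in `φ(K)`
(`fixedField_stabilizer_reflexLift_le_fieldRange`, Streng, *Complex multiplication of abelian surfaces* (2010)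
Ch. I Lemma 7.2 [Streng2010]: "`Kʳʳ` is a subfield of `K`"), with equality for a primitive type
(`IsPrimitive.fixedField_stabilizer_reflexLift_eq`: "if `Φ` is primitive, then `Kʳʳ = K`"), and the type
induced from the reflex of the reflex is `Φ` (`image_typeLift_mul_stabilizer_eq_of_normal`).

A ring-homomorphism flavour over `ℚ` (`ringEquivCompAction`: `L ≃+* L` acting on `K →+* L`, transitive for
`L/ℚ` normal, `exists_ringEquiv_smul_eq`) is included because CM types are usually sets of ring embeddings
(`Literature.AlgebraicGeometry.Motives.CMType`).

Everything here is proved.  The two `MulAction` instances are SCOPED (open the namespace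
`Literature.NumberTheory.ComplexMultiplication` to use them); Mathlib has no instance on these pairs of types.

## Provenance

Staged by the pub-hodgecm formalisation cell (DAG-node prover #04 lineage) under the LEAN-IN-TREE rule; supersedes
the standalone package's `HodgeCM.CMTypeOps.autActionHom` / `isPretransitive_autHom` (files
`HodgeCM/CM/ReflexInflateDict.lean`, `HodgeCM/CM/TypeOfDet.lean` §(C′)).
-/

set_option autoImplicit false

open scoped Pointwise

namespace Literature.NumberTheory.ComplexMultiplication

section AlgHom

variable (F K Ω : Type*) [Field F] [Field K] [Field Ω] [Algebra F K] [Algebra F Ω]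

/-- `Gal(Ω/F)` acts on the `F`-embeddings `K →ₐ[F] Ω` by composition: `σ • φ = σ ∘ φ` (Shimura's "elements of
`G` inducing `φᵢ` on `F`", in composition order). Scoped. [cite: Shimura1998, §8.1 Prop. 25] -/
scoped instance algEquivCompAction : MulAction (Ω ≃ₐ[F] Ω) (K →ₐ[F] Ω) where
  smul σ φ := (σ : Ω →ₐ[F] Ω).comp φ
  one_smul φ := by ext; rfl
  mul_smul σ τ φ := by ext; rfl

variable {F K Ω}

/-- [folklore] -/
theorem algEquiv_smul_def (σ : Ω ≃ₐ[F] Ω) (φ : K →ₐ[F] Ω) : σ • φ = (σ : Ω →ₐ[F] Ω).comp φ := rfl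

/-- [folklore] -/
@[simp] theorem algEquiv_smul_apply (σ : Ω ≃ₐ[F] Ω) (φ : K →ₐ[F] Ω) (x : K) : (σ • φ) x = σ (φ x) := rfl

/-- **Transitivity**: over a normal extension `Ω/F` any two `F`-embeddings `K → Ω` differ by an automorphism
of `Ω` (extend `φ' ∘ φ⁻¹ : φ(K) → Ω` to `Ω`). [folklore] -/
theorem exists_algEquiv_smul_eq [Normal F Ω] (φ φ' : K →ₐ[F] Ω) : ∃ σ : Ω ≃ₐ[F] Ω, σ • φ = φ' := by
  letI : Algebra K Ω := φ.toRingHom.toAlgebra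
  haveI : IsScalarTower F K Ω := IsScalarTower.of_algebraMap_eq fun x => (φ.commutes x).symm
  let ψ : Ω →ₐ[F] Ω := φ'.liftNormal Ω
  refine ⟨AlgEquiv.ofBijective ψ (Algebra.IsAlgebraic.algHom_bijective ψ), ?_⟩
  ext x
  have h := AlgHom.liftNormal_commutes φ' Ω x
  rw [RingHom.algebraMap_toAlgebra] at h
  exact h

/-- The action of `Gal(Ω/F)` on `Hom_F(K, Ω)` is transitive for `Ω/F` normal. Scoped. [folklore] -/
scoped instance isPretransitive_algEquiv_algHom [Normal F Ω] :
    MulAction.IsPretransitive (Ω ≃ₐ[F] Ω) (K →ₐ[F] Ω) :=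
  ⟨exists_algEquiv_smul_eq⟩

/-- `σ` fixes the embedding `φ` iff it fixes `φ(K)` pointwise. [folklore] -/
theorem mem_stabilizer_algHom_iff (σ : Ω ≃ₐ[F] Ω) (φ : K →ₐ[F] Ω) :
    σ ∈ MulAction.stabilizer (Ω ≃ₐ[F] Ω) φ ↔ ∀ x : K, σ (φ x) = φ x := by
  rw [MulAction.mem_stabilizer_iff]
  constructor
  · intro h x
    have := AlgHom.congr_fun h x
    simpa using this
  · intro h
    ext x
    simpa using h x

/-- `H₁ = Stab(φ) = Gal(Ω/φ(K))` (Shimura's "`H₁` the subgroup of `G` corresponding to `F`").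
[cite: Shimura1998, §8.2 Prop. 26] -/
theorem stabilizer_algHom_eq_fixingSubgroup (φ : K →ₐ[F] Ω) :
    MulAction.stabilizer (Ω ≃ₐ[F] Ω) φ = φ.fieldRange.fixingSubgroup := by
  ext σ
  rw [mem_stabilizer_algHom_iff, IntermediateField.mem_fixingSubgroup_iff]
  constructor
  · rintro h x ⟨y, rfl⟩
    exact h y
  · intro h x
    exact h (φ x) ⟨x, rfl⟩

/-- In the Galois case the fixed field of `H₁ = Stab(φ)` is `φ(K)`. [folklore] -/
theorem fixedField_stabilizer_algHom [IsGalois F Ω] (φ : K →ₐ[F] Ω) :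
    IntermediateField.fixedField (MulAction.stabilizer (Ω ≃ₐ[F] Ω) φ) = φ.fieldRange := by
  rw [stabilizer_algHom_eq_fixingSubgroup, InfiniteGalois.fixedField_fixingSubgroup]

/-- **`Kʳʳ ⊆ K`**: the reflex field of the reflex type (the fixed field of `H'`) lies in `φ(K)`.
[cite: Streng2010, Ch. I Lemma 7.2] -/
theorem fixedField_stabilizer_reflexLift_le_fieldRange [IsGalois F Ω] (Φ : Set (K →ₐ[F] Ω)) (φ : K →ₐ[F] Ω) :
    IntermediateField.fixedField
        (MulAction.stabilizer (Ω ≃ₐ[F] Ω) (reflexLift Φ φ : Set (Ω ≃ₐ[F] Ω))) ≤ φ.fieldRange := by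
  rw [← fixedField_stabilizer_algHom]
  exact fixedField_stabilizer_reflexLift_le F Ω Φ φ

/-- **`Kʳʳ = K` for a primitive type.** [cite: Streng2010, Ch. I Lemma 7.2] -/
theorem IsPrimitive.fixedField_stabilizer_reflexLift_eq [IsGalois F Ω] {Φ : Set (K →ₐ[F] Ω)} {φ : K →ₐ[F] Ω}
    (hP : IsPrimitive (Ω ≃ₐ[F] Ω) Φ φ) :
    IntermediateField.fixedField
        (MulAction.stabilizer (Ω ≃ₐ[F] Ω) (reflexLift Φ φ : Set (Ω ≃ₐ[F] Ω))) = φ.fieldRange := by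
  rw [hP.stabilizer_reflexLift_eq, fixedField_stabilizer_algHom]

/-- **`Φ` is induced by `Φʳʳ`** on embeddings: `{σ ∘ φ | σ ∈ S · H'} = Φ` for `Ω/F` normal.
[cite: Streng2010, Ch. I Lemma 7.2] -/
theorem image_typeLift_mul_stabilizer_eq_of_normal [Normal F Ω] (Φ : Set (K →ₐ[F] Ω)) (φ : K →ₐ[F] Ω) :
    (fun σ : Ω ≃ₐ[F] Ω => σ • φ) ''
        (typeLift Φ φ * (MulAction.stabilizer (Ω ≃ₐ[F] Ω) (reflexLift Φ φ : Set (Ω ≃ₐ[F] Ω)) :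
          Set (Ω ≃ₐ[F] Ω))) = Φ :=
  image_typeLift_mul_stabilizer_eq Φ φ

/-- The reflex field of a type of `F`-embeddings, `K* = Ω^{Stab(Φ)}` (`reflexField` in this instance), lies in
any intermediate field `T` such that `S*` is right-`Gal(Ω/T)`-invariant. [folklore] -/
theorem reflexField_le_of_forall_mul_mem_iff_of_isGalois [IsGalois F Ω] (Φ : Set (K →ₐ[F] Ω)) (φ : K →ₐ[F] Ω)
    (T : IntermediateField F Ω)
    (hT : ∀ h ∈ T.fixingSubgroup, ∀ τ : Ω ≃ₐ[F] Ω, τ * h ∈ reflexLift Φ φ ↔ τ ∈ reflexLift Φ φ) :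
    reflexField F Ω Φ ≤ T :=
  reflexField_le_of_forall_mul_mem_iff F Ω Φ φ T hT

end AlgHom

/-! ### Ring embeddings (base field `ℚ`) -/

section RingHom

variable (K L : Type*) [NonAssocSemiring K] [NonAssocSemiring L]

/-- `Aut(L)` acts on the ring embeddings `K →+* L` by composition: `g • j = g ∘ j`. Scoped. [folklore] -/
scoped instance ringEquivCompAction : MulAction (L ≃+* L) (K →+* L) where
  smul g j := g.toRingHom.comp j
  one_smul j := by ext; rfl
  mul_smul g h j := by ext; rfl

variable {K L}

/-- [folklore] -/
theorem ringEquiv_smul_def (g : L ≃+* L) (j : K →+* L) : g • j = g.toRingHom.comp j := rfl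

/-- [folklore] -/
@[simp] theorem ringEquiv_smul_apply (g : L ≃+* L) (j : K →+* L) (x : K) : (g • j) x = g (j x) := rfl

/-- `g` fixes the embedding `j` iff it fixes `j(K)` pointwise. [folklore] -/
theorem mem_stabilizer_ringHom_iff (g : L ≃+* L) (j : K →+* L) :
    g ∈ MulAction.stabilizer (L ≃+* L) j ↔ ∀ x : K, g (j x) = j x := by
  rw [MulAction.mem_stabilizer_iff]
  constructor
  · intro h x
    have := RingHom.congr_fun h x
    simpa using this
  · intro h
    exact RingHom.ext fun x => by simpa using h x

end RingHom

section RingHomField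

variable {K L : Type*} [Field K] [CharZero K] [Field L] [CharZero L]

/-- **Transitivity for ring embeddings**: if `L/ℚ` is normal, any two ring embeddings `K → L` of a field of
characteristic zero differ by a ring automorphism of `L`. [folklore] -/
theorem exists_ringEquiv_smul_eq [Normal ℚ L] (j j' : K →+* L) : ∃ g : L ≃+* L, g • j = j' := by
  obtain ⟨σ, hσ⟩ := exists_algEquiv_smul_eq (F := ℚ) j.toRatAlgHom j'.toRatAlgHom
  refine ⟨σ.toRingEquiv, RingHom.ext fun x => ?_⟩
  have := AlgHom.congr_fun hσ x
  simpa [RingHom.toRatAlgHom_apply] using this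

/-- The action of `Aut(L)` on `Hom(K, L)` is transitive for `L/ℚ` normal. Scoped. [folklore] -/
scoped instance isPretransitive_ringEquiv_ringHom [Normal ℚ L] :
    MulAction.IsPretransitive (L ≃+* L) (K →+* L) :=
  ⟨exists_ringEquiv_smul_eq⟩

/-- **`Φ` is induced by `Φʳʳ`** for a type `Φ ⊆ Hom(K, L)` of ring embeddings, `L/ℚ` normal:
`{g ∘ j | g ∈ S · H'} = Φ`. [cite: Streng2010, Ch. I Lemma 7.2] -/
theorem image_typeLift_mul_stabilizer_eq_ringHom [Normal ℚ L] (Φ : Set (K →+* L)) (j : K →+* L) :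
    (fun g : L ≃+* L => g • j) ''
        (typeLift Φ j * (MulAction.stabilizer (L ≃+* L) (reflexLift Φ j : Set (L ≃+* L)) : Set (L ≃+* L))) = Φ :=
  image_typeLift_mul_stabilizer_eq Φ j

end RingHomField

end Literature.NumberTheory.ComplexMultiplication
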